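import Mathlib.RingTheory.LaurentSeries
import Mathlib.RingTheory.MvPowerSeries.Basic
import Mathlib.Data.Finsupp.Weight
import Mathlib.Analysis.SpecialFunctions.Trigonometric.Basic
import Mathlib.RingTheory.Algebraic.Integral
import HarnessLib

/-!
# Ayoub's ANALYTIC relative Kontsevich–Zagier: the erratum (Thm. 1.1 under `π` algebraic over `k`) and the repaired Théorème 1.11

Topic `Literature/NumberTheory/Transcendental`; cite item `wi-04088` (route AyoubSpecialisation,
"localise at `π`" split), sibling of `AyoubRelative.lean` (which vends the purely algebraic
Théorème 1.7 and explains why Ann. of Math. 181 (2015) Thm. 4.25 is not vendored as printed; that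
file is deliberately NOT imported here — the two files only share the namespace `Literature.AyoubRel`).

Source: J. Ayoub, *La version relative de la conjecture des périodes de Kontsevich–Zagier
revisitée* (note, Univ. Zürich; `AyoubRelKZRevisited`), §1.1 and §1.3. Fix a field `k` of
characteristic `0` and a complex embedding `σ : k ↪ ℂ`.

* `𝒪_{k-alg}(𝔻̄^∞)` (§1.1): formal power series in `z = (z₁, z₂, …)` (coefficients in `ℂ`) depending
  on finitely many `zᵢ`, with polyradius of convergence `> 1` along each axis (w.r.t. `σ`), and
  algebraic over `k(z)`; the integration morphism (1) `∫_{[0,1]^∞} : 𝒪_{k-alg}(𝔻̄^∞) → ℂ`, whose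
  image is `𝒫^{eff}(k, σ)` (Notation 1.9 (ii)).
* `𝒪†_{k-alg}(𝔻̄^∞)` (§1.1): Laurent series in `ϖ` with coefficients in `𝒪_{k-alg}(𝔻̄^∞)` that are
  algebraic over `k(z, ϖ)`; term-by-term integration (2) `𝒪†_{k-alg}(𝔻̄^∞) → ℂ((ϖ))`.
* **Théorème 1.1** (= Annals Thm. 4.25 WITH the hypothesis restored by the erratum Remarque 1.3):
  *suppose `π ∈ ℂ` is algebraic over `k`.* Then the kernel of (2) is the `k`-subspace spanned by
  (a) `∂G/∂zᵢ - G|_{zᵢ=1} + G|_{zᵢ=0}`, `G ∈ 𝒪†`, `i ≥ 1`; (b) `f · L`, `f ∈ 𝒪_{k-alg}(𝔻̄^∞)` with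
  `∫ f = 0`, `L ∈ 𝒪†`, `f` and `L` not depending simultaneously on a same variable.
  Remarque 1.3: without the hypothesis the statement is NOT known ("On ignore si [5, Théorèmes 3.27
  et 4.25] sont vrais sans l'hypothèse que `π ∈ ℂ` est algébrique sur `k`").
* **Théorème 1.11** (repairs Annals 4.25 for every `σ`): with `𝒫†,eff(k, σ) := 𝒪† / ⟨(a), (b)⟩_k`
  (Notation 1.9 (ii), a `𝒫^{eff}(k, σ)`-module through the disjoint-variable product) and
  `𝒫†(k, σ) := 𝒫†,eff(k, σ)[(2πi)⁻¹]` (Notation 1.9 (iii); `2πi ∈ 𝒫^{eff}(k, σ)`), term-by-term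
  integration `𝒫†(k, σ) → ℂ((ϖ))` is INJECTIVE.

## Lean rendering (honest definitions; nothing asserted)

* `CSeries = MvPowerSeries ℕ ℂ` (`ℂ[[z₀, z₁, …]]`; the note's variables `z₁, z₂, …` are indexed by
  `ℕ` here, as in `AyoubRelative.lean`); `DependsOnlyOnLT`, `UsesVar`, `HasPolyradiusGtOne`
  (`∃ r > 1, Σ_a ‖c_a‖ r^{|a|} < ∞`), `IsAlgebraicOverRatFunc σ` (a non-zero `P ∈ k[z][Y]` with
  `P(F) = 0` in `ℂ[[z]]`, coefficients pushed along `σ`; equivalent to algebraicity over `k(z)` by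
  clearing denominators), `Oan σ = 𝒪_{k-alg}(𝔻̄^∞)` as a `Set CSeries`; `intC` = the absolutely
  convergent sum `Σ_a c_a ∏ᵢ (aᵢ + 1)⁻¹` (`= ∫_{[0,1]^m}`, junk `tsum` value off `Oan`).
* `OanDagger σ ⊆ LaurentSeries CSeries` (`𝒪†_{k-alg}(𝔻̄^∞)`), `intCLaurent` (the map (2)),
  `pdz`, `restrC i c` (`G|_{zᵢ = c}`, a convergent `tsum` on `Oan`), `relAC i`, the generator sets
  `anGenA σ`, `anGenB σ` and `kSpan σ S` (finite `σ(k)`-linear combinations — the `k`-structure on a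
  `ℂ`-module along `σ`, written out to avoid a `Module k ℂ` instance).
* `IsPiAlgebraicOver σ` (the erratum's hypothesis "`π` algebraic over `k`") is a PREDICATE on the
  embedding, not a fact: `↔ IsAlgebraic k (π : ℂ)` along `σ.toAlgebra`; true for `Complex.ofRealHom`,
  false for `k = ℚ` and for every `k` algebraic over `ℚ` (Lindemann; `not_isPiAlgebraicOver_rat`,
  `not_isPiAlgebraicOver_of_isAlgebraic` in the sibling `AyoubPeriodSeriesPiAlgebraic.lean`).
* Facts: `ayoub_generators_le_kernel` (the maps (6) are well defined: generators integrate to `0`;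
  DISCHARGED in `AyoubPeriodSeriesKernel.lean`, `ayoub_generators_le_kernel_holds`), and
  `ayoub_integration_injective_localized` (Thm. 1.11), the latter unpacked elementarily: since
  `c · [F] := [g • F]` for any `g ∈ 𝒪_{k-alg}(𝔻̄^∞)` in variables disjoint from `F` with `∫ g = c`
  defines the `𝒫^{eff}`-module structure (well defined exactly by the relations (b)), injectivity of
  `𝒫†,eff[(2πi)⁻¹] → ℂ((ϖ))` says: `∫ F = 0 ⟹ ∃ N, ∃ g` disjoint from `F` with `∫ g = (2πi)^N` and
  `g • F ∈ ⟨(a), (b)⟩_k` (module localisation at the multiplicative set `(2πi)^ℕ`).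
* Théorème 1.1 (the kernel statement under `IsPiAlgebraicOver σ`) is NOT vendored as a separate
  named fact: as the note itself says (§1.3, "le Théorème 1.11 … répare [5, Théorème 4.25] et
  généralise le Théorème 1.1"; Notation 1.9 (iii): when `π` is algebraic over `k`, `2πi` is
  invertible in `𝒫^{eff}(k, σ)` and `𝒫†,eff = 𝒫†`), it is the corollary of Théorème 1.11, and it is
  PROVED from the fact `ayoub_integration_injective_localized` in the sibling
  `AyoubPeriodSeriesPiAlgebraic.lean` (`ayoub_kernel_piAlgebraic_of_localized`,
  `ayoub_kernel_eq_kSpan_of_localized`: the constant `((2πi)^N)⁻¹` is algebraic over `k`, hence lies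
  in `𝒪_{k-alg}(𝔻̄^∞)`, so `(u⁻¹ g - 1) • F` is a type (b) generator; the inclusion `⟨(a), (b)⟩_k ⊆ ker`
  is `ayoub_generators_le_kernel_holds`).
* Consequence for the ledger (payload (i)): cite item `wi-03949` (Annals Thm. 4.25 over `ℚ̄` as a
  theorem) must not be vendored without `IsPiAlgebraicOver σ`; over `k ⊆ ℚ̄` that hypothesis is the
  transcendence of `π`'s negation, i.e. false, so only Thm. 1.11 / Thm. 1.7 apply there.

## Mathlib search

`MvPowerSeries`, `MvPolynomial.coeToMvPowerSeries.ringHom`, `HahnSeries`/`LaurentSeries`,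
`HahnSeries.C`, `HahnSeries.single`, `HahnSeries.map` (coefficientwise maps (2), (a)),
`Polynomial.eval₂RingHom`, `tsum`, `Finsupp.degree` are used;
Mathlib has no convergent/algebraic power-series germs on polydiscs, no period rings (searched
`polyradius`, `PeriodRing`, `KontsevichZagier`: only this tree's `Literature` files).
-/

noncomputable section

open Finsupp

namespace Literature.NumberTheory.Transcendental.AyoubRel

/-! ### `ℂ[[z]]` and the space `𝒪_{k-alg}(𝔻̄^∞)` -/

/-- `ℂ[[z₀, z₁, …]]`, formal power series in countably many variables over `ℂ`.
[cite: AyoubRelKZRevisited, §1.1] -/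
abbrev CSeries : Type := MvPowerSeries ℕ ℂ

section Analytic

variable {k : Type} [Field k] (σ : k →+* ℂ)

/-- `F` depends only on the variables `z₀, …, z_{m-1}`. [cite: AyoubRelKZRevisited, §1.1] -/
def DependsOnlyOnLT (F : CSeries) (m : ℕ) : Prop :=
  ∀ a : ℕ →₀ ℕ, (∃ i, m ≤ i ∧ a i ≠ 0) → MvPowerSeries.coeff a F = 0

/-- `F` involves the variable `zᵢ` (some monomial with `aᵢ ≠ 0` has non-zero coefficient).
[cite: AyoubRelKZRevisited, Théorème 1.1 (b)] -/
def UsesVar (F : CSeries) (i : ℕ) : Prop :=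
  ∃ a : ℕ →₀ ℕ, a i ≠ 0 ∧ MvPowerSeries.coeff a F ≠ 0

/-- Polyradius of convergence `> 1` along each axis: `Σ_a ‖c_a‖ r^{|a|} < ∞` for some `r > 1`
(so `F` converges absolutely on a closed polydisc of polyradius `> 1`; the note's
"polyrayon de convergence strictement plus grand que `1` le long de chaque axe").
[cite: AyoubRelKZRevisited, §1.1] -/
def HasPolyradiusGtOne (F : CSeries) : Prop :=
  ∃ r : ℝ, 1 < r ∧ Summable fun a : ℕ →₀ ℕ => ‖MvPowerSeries.coeff a F‖ * r ^ (degree a)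

/-- `k[z] → ℂ[[z]]` along the embedding `σ`. [cite: AyoubRelKZRevisited, §1.1] -/
def polyToCSeries : MvPolynomial ℕ k →+* CSeries :=
  (MvPolynomial.coeToMvPowerSeries.ringHom).comp (MvPolynomial.map σ)

/-- `F ∈ ℂ[[z]]` is algebraic over `k(z)` (w.r.t. `σ`): some non-zero `P ∈ k[z][Y]` has `P(F) = 0`
(clearing denominators, this is algebraicity over the field `k(z)`). [cite: AyoubRelKZRevisited, §1.1] -/
def IsAlgebraicOverRatFunc (F : CSeries) : Prop :=
  ∃ P : Polynomial (MvPolynomial ℕ k), P ≠ 0 ∧ Polynomial.eval₂ (polyToCSeries σ) F P = 0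

/-- **`𝒪_{k-alg}(𝔻̄^∞)`**: power series in finitely many `zᵢ`, of polyradius of convergence `> 1`
along each axis, algebraic over `k(z)`. [cite: AyoubRelKZRevisited, §1.1] -/
def Oan : Set CSeries :=
  {F | (∃ m, DependsOnlyOnLT F m) ∧ HasPolyradiusGtOne F ∧ IsAlgebraicOverRatFunc σ F}

/-- Membership in `𝒪_{k-alg}(𝔻̄^∞)`, unfolded. [cite: AyoubRelKZRevisited, §1.1] -/
theorem mem_Oan_iff (F : CSeries) : F ∈ Oan σ ↔
    (∃ m, DependsOnlyOnLT F m) ∧ HasPolyradiusGtOne F ∧ IsAlgebraicOverRatFunc σ F :=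
  Iff.rfl

/-- **The integration morphism (1)** `∫_{[0,1]^∞} : 𝒪_{k-alg}(𝔻̄^∞) → ℂ`, computed on the
absolutely convergent expansion: `∫ Σ_a c_a z^a = Σ_a c_a ∏ᵢ (aᵢ + 1)⁻¹`
(`∫₀¹ zᵢ^{aᵢ} dzᵢ = (aᵢ + 1)⁻¹`). Junk `tsum` value (`0`) when the sum diverges, i.e. off `Oan`.
Its image is the period algebra `𝒫^{eff}(k, σ)` (Notation 1.9 (ii)). [cite: AyoubRelKZRevisited, §1.1 (1)] -/
def intC (F : CSeries) : ℂ :=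
  ∑' a : ℕ →₀ ℕ, MvPowerSeries.coeff a F * ∏ i ∈ a.support, ((a i : ℂ) + 1)⁻¹

omit [Field k] in
/-- `∫ 0 = 0`. [folklore] -/
@[simp] theorem intC_zero : intC 0 = 0 := by
  simp [intC]

/-- `∫ z^a = ∏ᵢ (aᵢ + 1)⁻¹`. [cite: AyoubRelKZRevisited, Lemme 1.4] -/
theorem intC_monomial (a : ℕ →₀ ℕ) :
    intC (MvPowerSeries.monomial a (1 : ℂ)) = ∏ i ∈ a.support, ((a i : ℂ) + 1)⁻¹ := by
  classical
  rw [intC, tsum_eq_single a]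
  · simp [MvPowerSeries.coeff_monomial_same]
  · intro b hb
    simp [MvPowerSeries.coeff_monomial, hb]

/-- `∫ 1 = 1`. [folklore] -/
@[simp] theorem intC_one : intC (1 : CSeries) = 1 := by
  classical
  rw [intC, tsum_eq_single 0]
  · simp [MvPowerSeries.coeff_zero_one]
  · intro b hb
    simp [MvPowerSeries.coeff_one, hb]

/-- `1 ∈ 𝒪_{k-alg}(𝔻̄^∞)` (depends on no variable, entire, root of `Y - 1`). [folklore] -/
theorem one_mem_Oan : (1 : CSeries) ∈ Oan σ := by
  classical
  refine ⟨⟨0, fun a ⟨i, _, hi⟩ => ?_⟩, ⟨2, one_lt_two, ?_⟩, ⟨Polynomial.X - Polynomial.C 1,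
    Polynomial.X_sub_C_ne_zero 1, by simp [Polynomial.eval₂_sub]⟩⟩
  · rw [MvPowerSeries.coeff_one, if_neg]
    rintro rfl
    exact hi rfl
  · refine summable_of_ne_finset_zero (s := {0}) fun a ha => ?_
    rw [Finset.mem_singleton] at ha
    simp [MvPowerSeries.coeff_one, ha]

/-- The effective period algebra `𝒫^{eff}(k, σ) ⊆ ℂ`: the image of (1) (a `k`-subalgebra of `ℂ`;
here as a set). Not to be confused with `KZPeriods.periods` (the absolute Kontsevich–Zagier period
set over `ℚ̄`, defined by semialgebraic integrals). [cite: AyoubRelKZRevisited, Notation 1.9 (ii)] -/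
def effPeriods : Set ℂ := intC '' Oan σ

/-! ### Laurent series in `ϖ`: `𝒪†_{k-alg}(𝔻̄^∞)` and term-by-term integration -/

/-- `k[z][ϖ] → ℂ[[z]]((ϖ))`, `ϖ ↦ ϖ`, coefficients along `σ`. [cite: AyoubRelKZRevisited, §1.1] -/
def polyToCLaurent : Polynomial (MvPolynomial ℕ k) →+* LaurentSeries CSeries :=
  Polynomial.eval₂RingHom (HahnSeries.C.comp (polyToCSeries σ)) (HahnSeries.single (1 : ℤ) 1)

/-- `F ∈ ℂ[[z]]((ϖ))` is algebraic over `k(z, ϖ)`: some non-zero `P ∈ k[z][ϖ][Y]` has `P(F) = 0`.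
[cite: AyoubRelKZRevisited, §1.1] -/
def IsAlgebraicLaurentOverRatFunc (F : LaurentSeries CSeries) : Prop :=
  ∃ P : Polynomial (Polynomial (MvPolynomial ℕ k)), P ≠ 0 ∧
    Polynomial.eval₂ (polyToCLaurent σ) F P = 0

/-- **`𝒪†_{k-alg}(𝔻̄^∞)`**: Laurent series in `ϖ` with all coefficients in `𝒪_{k-alg}(𝔻̄^∞)`,
algebraic over `k(z, ϖ)` (so the coefficients involve finitely many `zᵢ` uniformly in the
`ϖ`-degree). [cite: AyoubRelKZRevisited, §1.1] -/
def OanDagger : Set (LaurentSeries CSeries) :=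
  {F | (∀ r : ℤ, F.coeff r ∈ Oan σ) ∧ IsAlgebraicLaurentOverRatFunc σ F}

/-- Membership in `𝒪†_{k-alg}(𝔻̄^∞)`, unfolded. [cite: AyoubRelKZRevisited, §1.1] -/
theorem mem_OanDagger_iff (F : LaurentSeries CSeries) : F ∈ OanDagger σ ↔
    (∀ r : ℤ, F.coeff r ∈ Oan σ) ∧ IsAlgebraicLaurentOverRatFunc σ F :=
  Iff.rfl

/-- **Term-by-term integration (2)** `𝒪†_{k-alg}(𝔻̄^∞) → ℂ((ϖ))`, `Σ f_r ϖ^r ↦ Σ (∫ f_r) ϖ^r`.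
[cite: AyoubRelKZRevisited, §1.1 (2)] -/
def intCLaurent (F : LaurentSeries CSeries) : LaurentSeries ℂ :=
  F.map (⟨intC, intC_zero⟩ : ZeroHom CSeries ℂ)

/-- Coefficients of the term-by-term integral. [cite: AyoubRelKZRevisited, §1.1 (2)] -/
@[simp] theorem coeff_intCLaurent (F : LaurentSeries CSeries) (r : ℤ) :
    (intCLaurent F).coeff r = intC (F.coeff r) := rfl

/-! ### The generators (a), (b) of Théorème 1.1 -/

/-- `∂/∂zᵢ` on `ℂ[[z]]`: `coeff_a (∂ᵢ F) = (aᵢ + 1) · coeff_{a + eᵢ} F`.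
[cite: AyoubRelKZRevisited, Théorème 1.1 (a)] -/
def pdz (i : ℕ) (F : CSeries) : CSeries :=
  fun a => ((a i : ℂ) + 1) * MvPowerSeries.coeff (a + Finsupp.single i 1) F

/-- Restriction `zᵢ = c` on `ℂ[[z]]` (`c ∈ {0, 1}` in the note): for `aᵢ = 0`,
`coeff_a (F|_{zᵢ=c}) = Σ_n coeff_{a + n eᵢ} F · c^n` (a convergent sum for `F ∈ 𝒪_{k-alg}(𝔻̄^∞)`
since the polyradius exceeds `1`; junk `tsum` value otherwise), and `0` for `aᵢ ≠ 0`.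
[cite: AyoubRelKZRevisited, Théorème 1.1 (a)] -/
def restrC (i : ℕ) (c : ℂ) (F : CSeries) : CSeries :=
  fun a => if a i = 0 then ∑' n : ℕ, MvPowerSeries.coeff (a + Finsupp.single i n) F * c ^ n else 0

/-- The type (a) operator `G ↦ ∂G/∂zᵢ - G|_{zᵢ=1} + G|_{zᵢ=0}` on `ℂ[[z]]`.
[cite: AyoubRelKZRevisited, Théorème 1.1 (a)] -/
def relAC (i : ℕ) (F : CSeries) : CSeries :=
  pdz i F - restrC i 1 F + restrC i 0 F

omit [Field k] in
/-- `∂ᵢ 0 = 0`. [folklore] -/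
@[simp] theorem pdz_zero (i : ℕ) : pdz i 0 = 0 := by
  ext a
  change ((a i : ℂ) + 1) * MvPowerSeries.coeff (a + Finsupp.single i 1) (0 : CSeries) = _
  simp

omit [Field k] in
/-- `0|_{zᵢ = c} = 0`. [folklore] -/
@[simp] theorem restrC_zero (i : ℕ) (c : ℂ) : restrC i c 0 = 0 := by
  ext a
  change (if a i = 0 then
      ∑' n : ℕ, MvPowerSeries.coeff (a + Finsupp.single i n) (0 : CSeries) * c ^ n else 0) = _
  simp

omit [Field k] in
/-- The type (a) operator kills `0` (needed to apply it coefficientwise). [folklore] -/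
@[simp] theorem relAC_zero (i : ℕ) : relAC i (0 : CSeries) = 0 := by
  simp [relAC]

/-- A Laurent series `L` involves the variable `zᵢ` if some coefficient does.
[cite: AyoubRelKZRevisited, Théorème 1.1 (b)] -/
def UsesVarL (L : LaurentSeries CSeries) (i : ℕ) : Prop :=
  ∃ r : ℤ, UsesVar (L.coeff r) i

/-- Type (a) generators: `∂G/∂zᵢ - G|_{zᵢ=1} + G|_{zᵢ=0}` (coefficientwise in `ϖ`),
`G ∈ 𝒪†_{k-alg}(𝔻̄^∞)`. [cite: AyoubRelKZRevisited, Théorème 1.1 (a)] -/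
def anGenA : Set (LaurentSeries CSeries) :=
  {x | ∃ G ∈ OanDagger σ, ∃ i : ℕ, x = G.map (⟨relAC i, relAC_zero i⟩ : ZeroHom CSeries CSeries)}

/-- Type (b) generators: `f · L` with `f ∈ 𝒪_{k-alg}(𝔻̄^∞)`, `∫ f = 0`, `L ∈ 𝒪†_{k-alg}(𝔻̄^∞)`, and
`f`, `L` not depending simultaneously on a same variable (`f • L` is the coefficientwise
product). [cite: AyoubRelKZRevisited, Théorème 1.1 (b)] -/
def anGenB : Set (LaurentSeries CSeries) :=
  {x | ∃ f ∈ Oan σ, intC f = 0 ∧ ∃ L ∈ OanDagger σ,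
    (∀ i, ¬ (UsesVar f i ∧ UsesVarL L i)) ∧ x = f • L}

/-- The generators (a) ∪ (b) of Théorème 1.1 / Notation 1.9 (ii). [cite: AyoubRelKZRevisited, Théorème 1.1] -/
def anGenerators : Set (LaurentSeries CSeries) := anGenA σ ∪ anGenB σ

/-- The `k`-span along `σ` of a subset `S` of a `ℂ`-module: finite combinations `Σ σ(cⱼ) • sⱼ`
(written out instead of a `Module k _` instance along `σ`). [cite: AyoubRelKZRevisited, Théorème 1.1] -/
def kSpan {M : Type*} [AddCommGroup M] [Module ℂ M] (S : Set M) : Set M :=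
  {x | ∃ (n : ℕ) (c : Fin n → k) (s : Fin n → M), (∀ j, s j ∈ S) ∧ x = ∑ j, (σ (c j)) • s j}

omit [Field k] in
/-- `S ⊆ kSpan σ S`. [folklore] -/
theorem subset_kSpan {k : Type} [Field k] (σ : k →+* ℂ) {M : Type*} [AddCommGroup M] [Module ℂ M]
    (S : Set M) : S ⊆ kSpan σ S := by
  intro x hx
  exact ⟨1, fun _ => 1, fun _ => x, fun _ => hx, by simp⟩

/-- `π ∈ ℂ` is algebraic over `k` (along `σ`): the HYPOTHESIS of Théorème 1.1 restored by the
erratum ("On suppose que `π ∈ ℂ` est algébrique sur `k`", Thm. 1.1; Remarque 1.3). This is a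
predicate on the embedding `σ : k →+* ℂ` (the binder is written explicitly so that it is not read as
a closed named fact): it HOLDS for `σ = Complex.ofRealHom` (`isPiAlgebraicOver_ofRealHom`) and FAILS
for every `k` algebraic over `ℚ` by Lindemann's theorem (`not_isPiAlgebraicOver_of_isAlgebraic` in
`AyoubPeriodSeriesPiAlgebraic.lean`); it is Mathlib's `IsAlgebraic k (π : ℂ)` for the algebra structure
`σ.toAlgebra` (`isPiAlgebraicOver_iff_isAlgebraic`).
[cite: AyoubRelKZRevisited, Théorème 1.1 and Remarque 1.3] -/
def IsPiAlgebraicOver (σ : k →+* ℂ) : Prop :=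
  ∃ p : Polynomial k, p ≠ 0 ∧ Polynomial.eval₂ σ (Real.pi : ℂ) p = 0

/-- `IsPiAlgebraicOver σ` is Mathlib's `IsAlgebraic k (π : ℂ)` for the `k`-algebra structure on `ℂ`
given by `σ` (definitionally: `aeval = eval₂ (algebraMap k ℂ)`). [folklore] -/
theorem isPiAlgebraicOver_iff_isAlgebraic :
    IsPiAlgebraicOver σ ↔ @IsAlgebraic k ℂ _ _ σ.toAlgebra (Real.pi : ℂ) :=
  Iff.rfl

/-- Equivalently (over a field, algebraic = integral): `π` is an integral element for the ring
map `σ`, i.e. a root of a MONIC polynomial with coefficients pushed along `σ`. [folklore] -/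
theorem isPiAlgebraicOver_iff_isIntegralElem :
    IsPiAlgebraicOver σ ↔ σ.IsIntegralElem (Real.pi : ℂ) := by
  letI := σ.toAlgebra
  rw [isPiAlgebraicOver_iff_isAlgebraic, isAlgebraic_iff_isIntegral]
  rfl

/-- The hypothesis is satisfiable: for `k = ℝ ⊂ ℂ`, `π` is a root of `X - π ∈ ℝ[X]`
(so Théorème 1.1 is not vacuous; likewise for `k = ℚ(π)`). [folklore] -/
theorem isPiAlgebraicOver_ofRealHom : IsPiAlgebraicOver Complex.ofRealHom :=
  ⟨Polynomial.X - Polynomial.C Real.pi, Polynomial.X_sub_C_ne_zero _, by simp⟩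

/-- For `k = ℚ` the hypothesis reads `IsAlgebraic ℚ (π : ℂ)`, the negation of Lindemann's theorem
(refuted in `AyoubPeriodSeriesPiAlgebraic.lean`, `not_isPiAlgebraicOver_rat`). [folklore] -/
theorem isPiAlgebraicOver_rat_iff :
    IsPiAlgebraicOver (algebraMap ℚ ℂ) ↔ IsAlgebraic ℚ (Real.pi : ℂ) :=
  Iff.rfl

end Analytic

/-! ### Named facts -/

/- Théorème 1.1 (= Ann. of Math. 181 (2015) Thm. 4.25 with the hypothesis of the erratum,
Remarque 1.3: for `π ∈ ℂ` algebraic over `k`, `F ∈ 𝒪†_{k-alg}(𝔻̄^∞)` has `∫ F = 0 ∈ ℂ((ϖ))` iff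
`F ∈ ⟨(a), (b)⟩_k`) was vendored here as the named fact `ayoub_kernel_piAlgebraic` until
2026-08-15. It is the corollary of Théorème 1.11 (`ayoub_integration_injective_localized` below)
and is now the theorem `ayoub_kernel_piAlgebraic_of_localized (h : ayoub_integration_injective_localized)`
(`ayoub_kernel_eq_kSpan_of_localized h` for the packaged `∀ k σ, …` form), PROVED from Théorème 1.11
in `AyoubPeriodSeriesPiAlgebraic.lean`; see the module docstring. -/

/-- **The maps (6) are well defined** (revisited note, §1.3, display (6)): term-by-term integration
kills the `k`-span of the generators (a), (b), for every complex embedding (no hypothesis on `π`;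
this is the elementary inclusion). [cite: AyoubRelKZRevisited, §1.3 (6)] -/
def ayoub_generators_le_kernel : Prop :=
  ∀ (k : Type) [Field k] [CharZero k] (σ : k →+* ℂ),
    ∀ x ∈ kSpan σ (anGenerators σ), intCLaurent x = 0

/-- **Ayoub, revisited note, Théorème 1.11 (repairs Annals Thm. 4.25 for every `σ`).** With
`𝒫†,eff(k, σ) = 𝒪†_{k-alg}(𝔻̄^∞) / ⟨(a), (b)⟩_k` and `𝒫†(k, σ) = 𝒫†,eff(k, σ)[(2πi)⁻¹]`
(Notation 1.9), term-by-term integration `𝒫†(k, σ) → ℂ((ϖ))` is injective. Unpacked (module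
localisation at `(2πi)^ℕ`, the `𝒫^{eff}`-action being `c · [F] = [g • F]` for `g` in variables
disjoint from `F` with `∫ g = c`, well defined by (b)): if `F ∈ 𝒪†_{k-alg}(𝔻̄^∞)` has `∫ F = 0`,
then for some `N` and some `g ∈ 𝒪_{k-alg}(𝔻̄^∞)` in variables disjoint from those of `F` with
`∫ g = (2πi)^N`, `g • F` lies in the `k`-span of the generators. [cite: AyoubRelKZRevisited, Théorème 1.11] -/
def ayoub_integration_injective_localized : Prop :=
  ∀ (k : Type) [Field k] [CharZero k] (σ : k →+* ℂ),
    ∀ F ∈ OanDagger σ, intCLaurent F = 0 →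
      ∃ (N : ℕ) (g : CSeries), g ∈ Oan σ ∧ (∀ i, ¬ (UsesVar g i ∧ UsesVarL F i)) ∧
        intC g = (2 * Real.pi * Complex.I) ^ N ∧ g • F ∈ kSpan σ (anGenerators σ)

end Literature.NumberTheory.Transcendental.AyoubRel
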